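import Mathlib
import Literature.Topology.FourManifolds.TwoHandleTubeDeformationFour
import Literature.Topology.FourManifolds.LefschetzHandlebody
import Literature.Topology.FourManifolds.LefschetzBaseShadow
import Summits.SmoothPoincare4.SmoothPoincare4.Theorems.ConvexBisectionAcyclicBisectionExistsMultiAttachmentHomologyLoops
import Summits.SmoothPoincare4.SmoothPoincare4.Theorems.ConvexBisectionAcyclicBisectionExistsMultiAttachmentH1Model
import Summits.SmoothPoincare4.SmoothPoincare4.Theorems.ConvexBisectionAcyclicBisectionExistsMultiAttachmentH1Cores
import Summits.SmoothPoincare4.SmoothPoincare4.Theorems.ConvexBisectionAcyclicBisectionExistsMultiAttachmentH1Cover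
import HarnessLib

/-!
# `H₁` of a Kosinski multi-attachment of 4-dimensional 2-handles:
# `H₁(X; R) ≅ H₁(V; R) ⧸ ⟨attaching classes⟩`, and clause 2 of NF5
(helper for stub `stub_isLefschetzHandlebody_homology` = NF5
`Literature.Topology.FourManifolds.LefschetzBase.isLefschetzHandlebody_homology`, line
`modp-braid-orbits` r9, crux `ConvexBisection.AcyclicBisectionExists`, item stmt-SmoothPoincare4-10508;
wave 3 / W3-2: assembly of the multi-attachment `H₁` engine)

**E1 (`IsMultiAttachment.nonempty_equiv_quot_span`, stub `stub_multiAttachment_H1`).**  For a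
4-manifold with boundary `V`, attaching maps `h : ι → HandleAttachingMap 3 2 V` (`ι` finite) and
`X = V ∪ H² ∪ ⋯ ∪ H²` (`HandleAttachingMap.IsMultiAttachment h IP X`, Kosinski VI §6):
`H₁(X; R) ≅ H₁(V; R) ⧸ span {h(loopPath (h i).attachingCircle)}` (Gompf–Stipsicz 1999, §4.4:
*"`H₁(X ∪ 2-handles) = H₁(X)/⟨attaching circles⟩`"*).  Proof: `X` is covered by the open sets
`A = jA(V ∖ ⋃ cores)` and `Bᵢ = jBᵢ(D⁴ ∖ S)` (pairwise disjoint, contractible), with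
`A ∩ Bᵢ ≅ T ∖ S` the punctured tube of the `i`-th handle (§1); by the cover half
(`…MultiAttachmentH1Cover.lean`) `H₁(X) ≅ H₁(A) ⧸ span {cᵢ}` where `R ∙ cᵢ` is the image of
`H₁(A ∩ Bᵢ)`, i.e. (tube model, `…MultiAttachmentH1Model.lean`, with `range_map_one_eq_span`)
the span of the class of the parallel loop of the `i`-th handle (§2); finally
`H₁(A) ≅ H₁(V ∖ ⋃ cores) ≅ H₁(V)` (`…MultiAttachmentH1Cores.lean`) carries that class to the
class of the attaching loop (§3).

**E3 (`stub_isLefschetzHandlebody_homology_H1`) = clause 2 of NF5** for every genus and word: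
`IsLefschetzHandlebody g l X → H₁(X; ℤ) ≅ ℤ^{2g} ⧸ span (letters l)`, from E1 over `V = Base g`,
the homology shadow `shadowMap g : H₁(Base g; ℤ) ≅ ℤ^{2g}` (a bijection by Milnor's theorem
`exists_isChainShadow_of`, `LefschetzBaseShadow.lean`) and `IsLefschetzLink.shadow_eq` (§4).

Everything is proved; no named facts, no `sorry`, no definitions.  References: R. E. Gompf,
A. I. Stipsicz, *4-Manifolds and Kirby Calculus* (1999), §4.4, §8.2 [GompfStipsicz1999];
A. A. Kosinski, *Differential Manifolds* (1993), VI §6 [Kosinski1993]; A. Kas, Pacific J. Math.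
89 (1980) [Kas1980]; A. Hatcher, *Algebraic Topology* (2002), §2.2, Thm. 2A.1 [HatcherAT2002].
-/

noncomputable section

-- the prescribed namespace `Summit.<P>.<Sub>.…` duplicates `SmoothPoincare4` (P = Sub)
set_option linter.dupNamespace false

open scoped Manifold ContDiff Topology
open Set Function Metric CategoryTheory CategoryTheory.Limits
open Literature.AlgebraicTopology.SingularHomology Literature.AlgebraicTopology.Homotopy
open Literature.Topology.FourManifolds Literature.Topology.FourManifolds.LefschetzBase
open Literature.GroupTheory.CombinatorialGroupTheory.SignedHurwitz (letters)

namespace Summit.SmoothPoincare4.SmoothPoincare4.Theorems.AcyclicBisectionExists.ModpBraidOrbits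

universe u

variable (R : Type) [CommRing R]

section Engine

variable {V : Type} [TopologicalSpace V] [T2Space V] [ChartedSpace (EuclideanHalfSpace (3 + 1)) V]
  {ι : Type} [Finite ι] {h : ι → HandleAttachingMap 3 2 V}
  {X : Type} [TopologicalSpace X]
  {jA : ↥(HandleAttachingMap.coresComplement h) → X} {jB : ι → ↥(beltPiece 3 2) → X}

/-! ## §1 The gluing region of the `i`-th handle is a punctured tube -/

omit [T2Space V] [Finite ι] in
/-- With pairwise disjoint tubes, `h̄ᵢ(T ∖ S)` misses all the attaching circles. [folklore] -/
theorem apply_mem_coresComplement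
    (hdisj : Pairwise fun i j => Disjoint (range (h i).toFun) (range (h j).toFun)) (i : ι)
    (y : ↥{y : ↥(handleTube 3 2) | lamSq 2 y.1.1 ≠ 1}) : (h i).toFun y.1 ∈ (⋃ j, (h j).core)ᶜ :=
  ((compl_iUnion_core_inter_range₄ hdisj i).symm.subset ⟨y.1, y.2, rfl⟩).1

/-- **The punctured tube of the `i`-th handle, embedded in `X` through the base piece**:
`y ↦ jA(h̄ᵢ y)`. [cite: Kosinski1993, VI §6] -/
theorem isEmbedding_tubePiece (hjA : Topology.IsEmbedding jA)
    (hdisj : Pairwise fun i j => Disjoint (range (h i).toFun) (range (h j).toFun)) (i : ι) :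
    Topology.IsEmbedding fun y : ↥{y : ↥(handleTube 3 2) | lamSq 2 y.1.1 ≠ 1} =>
      jA ⟨(h i).toFun y.1, apply_mem_coresComplement hdisj i y⟩ := by
  refine hjA.comp ?_
  rw [← Topology.IsEmbedding.subtypeVal.of_comp_iff]
  exact (h i).isSmoothEmbedding.isEmbedding.comp Topology.IsEmbedding.subtypeVal

omit [TopologicalSpace X] in
/-- **The gluing region `jA(V ∖ ⋃ cores) ∩ jBᵢ(D⁴ ∖ S)` is the image of the punctured tube of the
`i`-th handle** (the identification `x ∼ h̄ᵢ α(x)` of Kosinski's model). [cite: Kosinski1993, VI §6] -/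
theorem range_tubePiece_eq
    (hdisj : Pairwise fun i j => Disjoint (range (h i).toFun) (range (h j).toFun))
    (hglue : ∀ i a b, jA a = jB i b ↔
      (h i).glueRel (a : V) (b : closedBall (0 : EuclideanSpace ℝ (Fin 4)) 1)) (i : ι) :
    range (fun y : ↥{y : ↥(handleTube 3 2) | lamSq 2 y.1.1 ≠ 1} =>
      jA ⟨(h i).toFun y.1, apply_mem_coresComplement hdisj i y⟩) = range jA ∩ range (jB i) := by
  ext w
  constructor
  · rintro ⟨y, rfl⟩
    refine ⟨mem_range_self _, ⟨(handleInversionPt y.1.1 y.1.2 y.2 : ↥(handleTube 3 2)).1,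
      (handleInversion_mem y.1.2 y.2).2.2⟩, ?_⟩
    rw [eq_comm, hglue i]
    exact ⟨y.1, y.2, rfl, rfl⟩
  · rintro ⟨⟨a, rfl⟩, b, hb⟩
    obtain ⟨y, hy, -, hya⟩ := (hglue i a b).1 hb.symm
    refine ⟨⟨y, hy⟩, ?_⟩
    show jA _ = jA a
    congr 1
    exact Subtype.ext hya.symm

/-! ## §2 The hypotheses of the cover half -/

/-- **The image of `H₁` of the gluing region `A ∩ Bᵢ ≅ T ∖ S` in `H₁(A)` is the span of the
class `cᵢ` of the parallel loop** (`range_map_one_eq_span` over the tube model).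
[cite: HatcherAT2002, Thm. 2A.1] -/
theorem range_edge_eq_span (hjA : Topology.IsEmbedding jA)
    (hdisj : Pairwise fun i j => Disjoint (range (h i).toFun) (range (h j).toFun))
    (hglue : ∀ i a b, jA a = jB i b ↔
      (h i).glueRel (a : V) (b : closedBall (0 : EuclideanSpace ℝ (Fin 4)) 1))
    {y₀ : ↥{y : ↥(handleTube 3 2) | lamSq 2 y.1.1 ≠ 1}} (L : Path y₀ y₀)
    (hL : ∀ γ : Path y₀ y₀, ∃ n : ℤ, FundamentalGroup.fromPath (Path.Homotopic.Quotient.mk γ) =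
      FundamentalGroup.fromPath (Path.Homotopic.Quotient.mk L) ^ n) (i : ι) :
    LinearMap.range (singularHomology.map R R (subsetInclusion (inter_subset_left :
        range jA ∩ range (jB i) ⊆ range jA)) 1).hom =
      Submodule.span R {loopClass R R (1 : R) (L.map
          ((continuous_inclusion (inter_subset_left :
              range jA ∩ range (jB i) ⊆ range jA)).comp
            (((isEmbedding_tubePiece hjA hdisj i).toHomeomorph.trans
              (Homeomorph.setCongr (range_tubePiece_eq hdisj hglue i))).continuous)))} := by
  haveI hTS : PathConnectedSpace ↥{y : ↥(handleTube 3 2) | lamSq 2 y.1.1 ≠ 1} :=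
    isPathConnected_iff_pathConnectedSpace.1 isPathConnected_handleTube₄_lamSq_ne_one
  set e : ↥{y : ↥(handleTube 3 2) | lamSq 2 y.1.1 ≠ 1} ≃ₜ ↥(range jA ∩ range (jB i)) :=
    (isEmbedding_tubePiece hjA hdisj i).toHomeomorph.trans
      (Homeomorph.setCongr (range_tubePiece_eq hdisj hglue i)) with he
  set f : C(↥{y : ↥(handleTube 3 2) | lamSq 2 y.1.1 ≠ 1}, ↥(range jA)) :=
    (subsetInclusion (inter_subset_left : range jA ∩ range (jB i) ⊆ range jA)).comp
      (e : C(_, _)) with hf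
  have hrange := range_map_one_eq_span R L hL f
  have hfac : singularHomology.map R R f 1 = (singularHomology.mapIso R R e 1).hom ≫
      singularHomology.map R R (subsetInclusion (inter_subset_left :
        range jA ∩ range (jB i) ⊆ range jA)) 1 := by
    rw [singularHomology.mapIso_hom, ← singularHomology.map_comp]
  rw [hfac, ModuleCat.hom_comp, LinearMap.range_comp, LinearMap.range_eq_top.2
    ((ConcreteCategory.isIso_iff_bijective (singularHomology.mapIso R R e 1).hom).1
      inferInstance).2, Submodule.map_top] at hrange
  exact hrange

/-- **The cover of a multi-attachment satisfies the hypotheses of `surjective_and_ker_cover`**,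
with `cᵢ` the class of the parallel loop of the `i`-th handle pushed into `A = jA(V ∖ ⋃ cores)`;
conclusion: `H₁(A) → H₁(X)` is onto with kernel the span of these classes.
[cite: GompfStipsicz1999, §4.4] -/
theorem surjective_and_ker_of_isMultiAttachment {EP HP : Type*} [NormedAddCommGroup EP]
    [NormedSpace ℝ EP] [TopologicalSpace HP] {IP : ModelWithCorners ℝ EP HP} [ChartedSpace HP X]
    (hdisj : Pairwise fun i j => Disjoint (range (h i).toFun) (range (h j).toFun))
    (hjA : Manifold.IsSmoothEmbedding (𝓡∂ (3 + 1)) IP ∞ jA) (hjAo : IsOpen (range jA))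
    (hjB : ∀ i, Manifold.IsSmoothEmbedding (𝓡∂ (3 + 1)) IP ∞ (jB i) ∧ IsOpen (range (jB i)))
    (hcov : range jA ∪ (⋃ i, range (jB i)) = univ)
    (hglue : ∀ i a b, jA a = jB i b ↔
      (h i).glueRel (a : V) (b : closedBall (0 : EuclideanSpace ℝ (Fin 4)) 1))
    (hdisjB : Pairwise fun i j => Disjoint (range (jB i)) (range (jB j)))
    {y₀ : ↥{y : ↥(handleTube 3 2) | lamSq 2 y.1.1 ≠ 1}} (L : Path y₀ y₀)
    (hL : ∀ γ : Path y₀ y₀, ∃ n : ℤ, FundamentalGroup.fromPath (Path.Homotopic.Quotient.mk γ) =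
      FundamentalGroup.fromPath (Path.Homotopic.Quotient.mk L) ^ n) :
    Function.Surjective (singularHomology.map R R (subsetIncl (range jA)) 1) ∧
      LinearMap.ker (singularHomology.map R R (subsetIncl (range jA)) 1).hom =
        Submodule.span R (range fun i => loopClass R R (1 : R) (L.map
          ((continuous_inclusion (inter_subset_left :
              range jA ∩ range (jB i) ⊆ range jA)).comp
            (((isEmbedding_tubePiece hjA.isEmbedding hdisj i).toHomeomorph.trans
              (Homeomorph.setCongr (range_tubePiece_eq hdisj hglue i))).continuous)))) := by
  have hpcB : ∀ i, ContractibleSpace ↥(range (jB i)) := fun i =>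
    (hjB i).1.isEmbedding.toHomeomorph.contractibleSpace_iff.1 contractibleSpace_beltPiece₄
  refine surjective_and_ker_cover R hjAo (fun i => (hjB i).2) hdisjB hcov (fun i => ?_)
    (fun i => inferInstance) (fun i => isZero_singularHomology_of_contractibleSpace R R one_ne_zero)
    (range_edge_eq_span R hjA.isEmbedding hdisj hglue L hL)
  -- `A ∩ Bᵢ ≅ T ∖ S` is path connected
  haveI : PathConnectedSpace ↥{y : ↥(handleTube 3 2) | lamSq 2 y.1.1 ≠ 1} :=
    isPathConnected_iff_pathConnectedSpace.1 isPathConnected_handleTube₄_lamSq_ne_one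
  rw [← range_tubePiece_eq hdisj hglue i]
  exact isPathConnected_iff_pathConnectedSpace.1
    (isPathConnected_range (isEmbedding_tubePiece hjA.isEmbedding hdisj i).continuous)

/-! ## §3 Transport to `H₁(V)` -/

/-- **The class `cᵢ ∈ H₁(A)` of the parallel loop of the `i`-th handle is carried by
`H₁(A) ≅ H₁(V ∖ ⋃ cores) → H₁(V)` to the class of the attaching loop `loopPath (h i).attachingCircle`.**
[cite: GompfStipsicz1999, §4.4] -/
theorem map_edgeClass_eq {EP HP : Type*} [NormedAddCommGroup EP]
    [NormedSpace ℝ EP] [TopologicalSpace HP] {IP : ModelWithCorners ℝ EP HP} [ChartedSpace HP X]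
    (hdisj : Pairwise fun i j => Disjoint (range (h i).toFun) (range (h j).toFun))
    (hjA : Manifold.IsSmoothEmbedding (𝓡∂ (3 + 1)) IP ∞ jA)
    (hglue : ∀ i a b, jA a = jB i b ↔
      (h i).glueRel (a : V) (b : closedBall (0 : EuclideanSpace ℝ (Fin 4)) 1))
    {y₀ : ↥{y : ↥(handleTube 3 2) | lamSq 2 y.1.1 ≠ 1}} (L : Path y₀ y₀)
    (hLclass : ∀ h' : HandleAttachingMap 3 2 V, loopClass R R (1 : R)
      (L.map (h'.continuous.comp continuous_subtype_val)) =
        loopClass R R (1 : R) (loopPath h'.attachingCircle h'.continuous_attachingCircle)) (i : ι) :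
    singularHomology.map R R (subsetIncl
        ((HandleAttachingMap.coresComplement h : TopologicalSpace.Opens V) : Set V)) 1
      (singularHomology.map R R (hjA.isEmbedding.toHomeomorph.symm :
          C(↥(range jA), ↥(HandleAttachingMap.coresComplement h))) 1
        (loopClass R R (1 : R) (L.map ((continuous_inclusion (inter_subset_left :
            range jA ∩ range (jB i) ⊆ range jA)).comp
          (((isEmbedding_tubePiece hjA.isEmbedding hdisj i).toHomeomorph.trans
            (Homeomorph.setCongr (range_tubePiece_eq hdisj hglue i))).continuous))))) =
      loopClass R R (1 : R) (loopPath (h i).attachingCircle (h i).continuous_attachingCircle) := by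
  rw [map_loopClass, map_loopClass, ← hLclass (h i)]
  refine loopClass_eq_of_coe_eq R _ _ (funext fun t => ?_)
  show (hjA.isEmbedding.toHomeomorph.symm ⟨jA ⟨(h i).toFun (L t).1, _⟩, _⟩ : V) = (h i).toFun (L t).1
  have e : (⟨jA ⟨(h i).toFun (L t).1, apply_mem_coresComplement hdisj i (L t)⟩, mem_range_self _⟩ :
      ↥(range jA)) = hjA.isEmbedding.toHomeomorph
        ⟨(h i).toFun (L t).1, apply_mem_coresComplement hdisj i (L t)⟩ :=
    Subtype.ext (hjA.isEmbedding.toHomeomorph_apply_coe _).symm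
  rw [e, Homeomorph.symm_apply_apply]

/-- **E1, with the multi-attachment data explicit.**  `H₁(X; R) ≅ H₁(V; R) ⧸ span` of the
classes of the attaching loops. [cite: GompfStipsicz1999, §4.4] -/
theorem nonempty_equiv_quot_of_data {EP HP : Type*} [NormedAddCommGroup EP]
    [NormedSpace ℝ EP] [TopologicalSpace HP] {IP : ModelWithCorners ℝ EP HP} [ChartedSpace HP X]
    (hdisj : Pairwise fun i j => Disjoint (range (h i).toFun) (range (h j).toFun))
    (hjA : Manifold.IsSmoothEmbedding (𝓡∂ (3 + 1)) IP ∞ jA) (hjAo : IsOpen (range jA))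
    (hjB : ∀ i, Manifold.IsSmoothEmbedding (𝓡∂ (3 + 1)) IP ∞ (jB i) ∧ IsOpen (range (jB i)))
    (hcov : range jA ∪ (⋃ i, range (jB i)) = univ)
    (hglue : ∀ i a b, jA a = jB i b ↔
      (h i).glueRel (a : V) (b : closedBall (0 : EuclideanSpace ℝ (Fin 4)) 1))
    (hdisjB : Pairwise fun i j => Disjoint (range (jB i)) (range (jB j))) :
    Nonempty (singularHomology R R X 1 ≃ₗ[R] singularHomology R R V 1 ⧸
      Submodule.span R (range fun i => loopClass R R (1 : R)
        (loopPath (h i).attachingCircle (h i).continuous_attachingCircle))) := by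
  -- the tube model
  obtain ⟨y₀, L, hL, hLclass⟩ := stub_multiAttachment_tubeModel
  obtain ⟨hsurj, hker⟩ := surjective_and_ker_of_isMultiAttachment R hdisj hjA hjAo hjB hcov hglue
    hdisjB L hL
  -- `H₁(X) ≅ H₁(A) ⧸ span {cᵢ}`
  have h₁ := nonempty_equiv_quot_of_surjective hsurj hker
  -- `H₁(A) ≅ H₁(V ∖ ⋃ cores) ≅ H₁(V)`
  let Ψ : ↥(HandleAttachingMap.coresComplement h) ≃ₜ ↥(range jA) := hjA.isEmbedding.toHomeomorph
  haveI hV : IsIso (singularHomology.map R R (subsetIncl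
      ((HandleAttachingMap.coresComplement h : TopologicalSpace.Opens V) : Set V)) 1) :=
    isIso_map_coresComplement_succ R R hdisj 0
  let T : singularHomology R R ↥(range jA) 1 ≃ₗ[R] singularHomology R R V 1 :=
    ((singularHomology.mapIso R R Ψ 1).symm ≪≫ asIso (singularHomology.map R R (subsetIncl
      ((HandleAttachingMap.coresComplement h : TopologicalSpace.Opens V) : Set V)) 1)).toLinearEquiv
  refine nonempty_equiv_quot_congr h₁ T (LinearEquiv.refl R _) ?_
  rw [Submodule.map_span, ← range_comp]
  congr 2
  funext i
  -- the class of the parallel loop is carried to the class of the attaching loop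
  simp only [T, Function.comp_apply, LinearEquiv.coe_coe, Iso.toLinearEquiv_apply, Iso.trans_hom,
    Iso.symm_hom, asIso_hom, singularHomology.mapIso_inv, ModuleCat.comp_apply]
  exact map_edgeClass_eq R hdisj hjA hglue L (fun h' => hLclass R V h') i

/-- **E1: `H₁` of a Kosinski multi-attachment of 4-dimensional 2-handles** — for attaching maps
`h : ι → HandleAttachingMap 3 2 V` and `X = V ∪ H² ∪ ⋯ ∪ H²`
(`HandleAttachingMap.IsMultiAttachment h IP X`), `H₁(X; R) ≅ H₁(V; R) ⧸ ⟨attaching classes⟩`,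
the attaching classes being the Hurewicz classes of the unit-period attaching loops
`loopPath (h i).attachingCircle`. [cite: GompfStipsicz1999, §4.4] -/
theorem IsMultiAttachment.nonempty_equiv_quot_span {EP HP : Type*} [NormedAddCommGroup EP]
    [NormedSpace ℝ EP] [TopologicalSpace HP] {IP : ModelWithCorners ℝ EP HP} [ChartedSpace HP X]
    (hX : HandleAttachingMap.IsMultiAttachment h IP X) :
    Nonempty (singularHomology R R X 1 ≃ₗ[R] singularHomology R R V 1 ⧸
      Submodule.span R (range fun i => loopClass R R (1 : R)
        (loopPath (h i).attachingCircle (h i).continuous_attachingCircle))) := by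
  obtain ⟨hdisj, jA, jB, hjA, hjAo, hjB, hcov, hglue, hdisjB⟩ := hX
  exact nonempty_equiv_quot_of_data R hdisj hjA hjAo hjB hcov hglue hdisjB

/-- **E1 = registered sub-goal stub `stub_multiAttachment_H1`** of
`stub_isLefschetzHandlebody_homology`: `H₁(X; R) ≅ H₁(V; R) ⧸ ⟨attaching classes⟩` for a
Kosinski multi-attachment `X` of 4-dimensional 2-handles to `V` (Gompf–Stipsicz 1999, §4.4).
[cite: GompfStipsicz1999, §4.4] -/
theorem stub_multiAttachment_H1 : ∀ (R : Type) [CommRing R] (V : Type) [TopologicalSpace V]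
    [T2Space V] [ChartedSpace (EuclideanHalfSpace (3 + 1)) V] (ι : Type) [Finite ι]
    (h : ι → Literature.Topology.FourManifolds.HandleAttachingMap 3 2 V) (X : Type)
    [TopologicalSpace X] [ChartedSpace (EuclideanHalfSpace 4) X],
    Literature.Topology.FourManifolds.HandleAttachingMap.IsMultiAttachment h (𝓡∂ 4) X →
    Nonempty (Literature.AlgebraicTopology.SingularHomology.singularHomology R R X 1 ≃ₗ[R]
      Literature.AlgebraicTopology.SingularHomology.singularHomology R R V 1 ⧸
        Submodule.span R (Set.range fun i =>
          Literature.AlgebraicTopology.SingularHomology.loopClass R R (1 : R)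
            (Literature.Topology.FourManifolds.LefschetzBase.loopPath (h i).attachingCircle
              (h i).continuous_attachingCircle))) :=
  fun R _ _ _ _ _ _ _ _ _ _ _ hX => IsMultiAttachment.nonempty_equiv_quot_span R hX

end Engine

/-! ## §4 Clause 2 of NF5 -/

/-- The letters of a word are the first components of its entries. [folklore] -/
theorem range_get_fst_eq_letters {W : Type*} (l : List (W × Bool)) :
    range (fun i : Fin l.length => (l.get i).1) = letters l := by
  ext v
  simp only [mem_range, letters, mem_setOf_eq]
  constructor
  · rintro ⟨i, rfl⟩
    exact ⟨(l.get i).2, List.get_mem l i⟩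
  · rintro ⟨s, hs⟩
    obtain ⟨i, hi⟩ := List.get_of_mem hs
    exact ⟨i, by rw [hi]⟩

/-- **Clause 2 of NF5 (`LefschetzBase.isLefschetzHandlebody_homology`), for every genus and
word**: the first homology of the (achiral) Lefschetz handlebody `X(F_{g,1}; l)` is
`ℤ^{2g} ⧸ ⟨letters of l⟩` — E1 over the base `Base g`, whose `H₁` the homology shadow identifies
with `ℤ^{2g}` (Milnor 1968 Thm. 9.1, `exists_isChainShadow_of`), the attaching classes going to
the letters (`IsLefschetzLink.shadow_eq`). (Registered sub-goal stub
`stub_isLefschetzHandlebody_homology_H1` of `stub_isLefschetzHandlebody_homology`.)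
[cite: GompfStipsicz1999, §8.2] [cite: Kas1980] -/
theorem stub_isLefschetzHandlebody_homology_H1 :
    ∀ (g : ℕ) (l : List ((Fin g ⊕ Fin g → ℤ) × Bool)) (X : Type) [TopologicalSpace X] [T2Space X]
      [SecondCountableTopology X] [CompactSpace X] [ChartedSpace (EuclideanHalfSpace 4) X]
      [IsManifold (𝓡∂ 4) ∞ X],
      Literature.Topology.FourManifolds.LefschetzBase.IsLefschetzHandlebody g l X →
        Nonempty ((Literature.AlgebraicTopology.SingularHomology.singularHomology ℤ ℤ X 1) ≃ₗ[ℤ]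
          ((Fin g ⊕ Fin g → ℤ) ⧸ Submodule.span ℤ
            (Literature.GroupTheory.CombinatorialGroupTheory.SignedHurwitz.letters l))) := by
  intro g l X _ _ _ _ _ _ hX
  obtain ⟨h, hlink, hmulti⟩ := hX
  have h₁ := IsMultiAttachment.nonempty_equiv_quot_span ℤ hmulti
  obtain ⟨hbij, -⟩ := isChainShadow_shadowMap g (exists_isChainShadow_of g)
  refine nonempty_equiv_quot_congr h₁ (LinearEquiv.ofBijective (shadowMap g) hbij)
    (LinearEquiv.refl ℤ _) ?_
  rw [Submodule.map_span, ← range_comp, ← range_get_fst_eq_letters]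
  congr 2
  funext i
  exact hlink.shadow_eq i

end Summit.SmoothPoincare4.SmoothPoincare4.Theorems.AcyclicBisectionExists.ModpBraidOrbits
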